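import Mathlib
import Summits.NavierStokesRegularity.NavierStokesRegularity.Theorems.FilamentSkeletonRssClause13ModelPieceFarOperator

/-!
# Clause 13-J/13-R, brick m3b-F (POINTWISE OPERATOR BOOKKEEPING ON THE FAR PIECE): `𝓛Y_H` in sup norms and the transport ODE it drives

Route `FilamentSkeletonRss`, ∃-side clause 13 (`Clause13RNearStraightL`, stmt-NavierStokesRegularity-23612; typing-agnostic).  Design of record
rev 80–82 (NOT DECOMPOSED YET, m3b = director default (ii) with tenure notes R-m3b-2/3): near the waist the far (ultra-high) piece
`Y_H = Y − k∗Y` of a variation is controlled by POINTWISE TRANSPORT (`…Clause13WaistFence`, `…Clause13WeightedFence`, p713320/p713880), for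
which one needs the forcing of the transport ODE in SUP norms.  This file is the sup-norm twin of `l2_modelOperator_far_le` (p704712):
for the model operator `𝓛Y = iG((2/q)Y − K_q∗Y) − wY′ + β₁Y + β₂conj Y` (`K_q(s) = (2q−s²)(s²+q)^{-5/2}`), a near kernel `k` (real `C¹`,
bounded, `k, t k, t²k′ ∈ L¹`), `w ∈ C²` (`|w′| ≤ Λ`, `|w″| ≤ Λ₂`), `β_i` continuous, bounded, `L_i`-Lipschitz, and `Y ∈ C¹_c`:
* §1 `norm_integral_kernel_mul_le_sup`, `integral_kernel_mul_norm_le_sup` — `‖∫K(x−y)f(y)dy‖ ≤ ‖K‖₁·sup‖f‖` (no support hypothesis on `f`);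
* §2 `modelOperator_far_eq` — the POINTWISE IDENTITY behind p704712:
  `𝓛Y_H(x) = 𝓛Y(x) − (k∗𝓛Y)(x) + w′(x)·P_T(x) − Rem(x) + M₁(x) + M₂(x)` with the transition piece `P_T = (t k′ + k)∗Y`, the second-order
  transport remainder `Rem` of `…Clause13CutoffCommutatorRefined` and the multiplier commutators `M_i = ∫k(x−y)(β_i(y)−β_i(x))(…)dy`;
  `norm_modelOperator_far_le` — hence `‖𝓛Y_H(x)‖ ≤ (1+‖k‖₁)·S_L + Λ‖P_T(x)‖ + (Λ₂(‖t²k′‖₁+‖t k‖₁) + (L₁+L₂)‖t k‖₁)·S_Y` whenever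
  `‖𝓛Y‖ ≤ S_L` and `‖Y‖ ≤ S_Y` everywhere (the transition piece is kept explicit: it lives in a window with a large skew gain);
* §3 `hasDerivAt_far`, `far_transport_ode`, `norm_far_forcing_le` — the far piece solves, at every `x`, the lab-frame transport equation of
  the fences, `w(x)·Y_H′(x) = i(2G/q)·Y_H(x) + β₁(x)Y_H(x) + β₂(x)conj Y_H(x) + f(x)` with `f := −iG·(K_q∗Y_H)(x) − 𝓛Y_H(x)`, and
  `‖f(x)‖ ≤ G‖(K_q∗Y_H)(x)‖ + ‖𝓛Y_H(x)‖`; the smoothing tail `K_q∗Y_H` (exponentially small in the spectral cut) is bounded in a separate file.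
Lane ns-filament-19175-p1 g18; `--supports stmt-NavierStokesRegularity-23612 --as helper`.
HONEST FRAMING: bookkeeping about an explicit 1-D model operator attached to a HYPOTHETICAL filament skeleton on the NEGATIVE side of a MODEL route;
nothing here bears on Navier–Stokes regularity or blow-up; 23610/23612 stay OPEN.
-/

noncomputable section

open MeasureTheory Real Complex Filter Set
open scoped ComplexConjugate Topology

namespace Summit.NavierStokesRegularity.NavierStokesRegularity.Theorems.MatchedKernel
set_option linter.dupNamespace false

/-! ## §1 Sup bound for a kernel integral against a bounded function -/

/-- **`‖∫K(x−y)f(y)dy‖ ≤ ‖K‖₁·M`** for an integrable real kernel `K` and any `f` with `‖f‖ ≤ M` everywhere (no support or measurability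
hypothesis on `f` is needed for the inequality). [folklore] -/
theorem norm_integral_kernel_mul_le_sup {K : ℝ → ℝ} (hK : Integrable K) {f : ℝ → ℂ} {M : ℝ} (hf : ∀ y, ‖f y‖ ≤ M) (x : ℝ) :
    ‖∫ y : ℝ, ((K (x - y) : ℝ) : ℂ) * f y‖ ≤ (∫ t, |K t|) * M := by
  have hKx : Integrable (fun y : ℝ => K (x - y)) := hK.comp_sub_left x
  have hint : Integrable (fun y : ℝ => |K (x - y)| * M) := hKx.abs.mul_const M
  calc ‖∫ y : ℝ, ((K (x - y) : ℝ) : ℂ) * f y‖ ≤ ∫ y : ℝ, |K (x - y)| * M := by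
        refine norm_integral_le_of_norm_le hint (ae_of_all _ fun y => ?_)
        rw [norm_mul, Complex.norm_real, Real.norm_eq_abs]
        exact mul_le_mul_of_nonneg_left (hf y) (abs_nonneg _)
    _ = (∫ t, |K t|) * M := by
        rw [integral_mul_const, integral_sub_left_eq_self (fun t => |K t|) volume x]

/-- **Weighted variant**: `∫ K(x−y)·‖f(y)‖ dy ≤ ‖K‖₁·M` for an integrable real weight `K` (e.g. the commutator weights of
`…Clause13CutoffCommutator(Refined)`) and a continuous `f` with `‖f‖ ≤ M`. [folklore] -/
theorem integral_kernel_mul_norm_le_sup {K : ℝ → ℝ} (hK : Integrable K) {f : ℝ → ℂ} (hfc : Continuous f) {M : ℝ}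
    (hf : ∀ y, ‖f y‖ ≤ M) (x : ℝ) :
    ∫ y : ℝ, K (x - y) * ‖f y‖ ≤ (∫ t, |K t|) * M := by
  have hKx : Integrable (fun y : ℝ => K (x - y)) := hK.comp_sub_left x
  have hint : Integrable (fun y : ℝ => |K (x - y)| * M) := hKx.abs.mul_const M
  have hL : Integrable (fun y : ℝ => K (x - y) * ‖f y‖) := by
    have h := hKx.bdd_mul hfc.norm.aestronglyMeasurable (c := M)
      (ae_of_all _ fun y => by rw [Real.norm_of_nonneg (norm_nonneg _)]; exact hf y)
    refine h.congr (ae_of_all _ fun y => ?_)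
    simp only [mul_comm]
  have h1 : ∫ y : ℝ, K (x - y) * ‖f y‖ ≤ ∫ y : ℝ, |K (x - y)| * M := by
    refine integral_mono hL hint fun y => ?_
    have h2 : K (x - y) * ‖f y‖ ≤ |K (x - y)| * ‖f y‖ := mul_le_mul_of_nonneg_right (le_abs_self _) (norm_nonneg _)
    exact h2.trans (mul_le_mul_of_nonneg_left (hf y) (abs_nonneg _))
  refine h1.trans (le_of_eq ?_)
  rw [integral_mul_const, integral_sub_left_eq_self (fun t => |K t|) volume x]

/-! ## §2 The pointwise identity for `𝓛Y_H` and its sup bound -/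

/-- **`𝓛Y_H` POINTWISE.**  `q > 0`; `k` real `C¹`, bounded, integrable; `Y ∈ C¹_c`; `w` with `w′` differentiable and `|w′| ≤ Λ`; `β_i` continuous
and bounded.  With `P = k∗Y`, `P′ = k∗Y′`, `Y_H = Y − P`, the transition piece `P_T(x) = ∫((x−y)k′(x−y) + k(x−y))Y(y)dy`, the second-order
remainder `Rem(x) = ∫[k′(x−y)(w(y)−w(x)−w′(x)(y−x)) − k(x−y)(w′(y)−w′(x))]Y(y)dy` and `M₁(x) = ∫k(x−y)(β₁(y)−β₁(x))Y(y)dy`,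
`M₂(x) = ∫k(x−y)(β₂(y)−β₂(x))conj Y(y)dy`:
`𝓛Y_H(x) = 𝓛Y(x) − ∫k(x−y)(𝓛Y)(y)dy + w′(x)P_T(x) − Rem(x) + M₁(x) + M₂(x)` — linearity `𝓛Y_H = 𝓛Y − 𝓛P`, the piece–operator identity
`pieceOperator_eq` (p700576) and the refined transport commutator (p697060). [folklore] -/
theorem modelOperator_far_eq {q G : ℝ} (hq : 0 < q) {k k' : ℝ → ℝ} (hk : ∀ t, HasDerivAt k (k' t) t) (hk'c : Continuous k')
    (hki : Integrable k) {Mk : ℝ} (hkM : ∀ t, |k t| ≤ Mk)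
    {Y : ℝ → ℂ} (hY : ContDiff ℝ 1 Y) (hYs : HasCompactSupport Y)
    {w : ℝ → ℝ} (hw : Differentiable ℝ w) (hw2 : Differentiable ℝ (deriv w)) {Λ : ℝ} (hΛ : ∀ t, |deriv w t| ≤ Λ)
    {β₁ β₂ : ℝ → ℂ} (hβ₁c : Continuous β₁) (hβ₂c : Continuous β₂) {b₁ b₂ : ℝ}
    (hb₁ : ∀ τ, ‖β₁ τ‖ ≤ b₁) (hb₂ : ∀ τ, ‖β₂ τ‖ ≤ b₂) (x : ℝ) :
    I * (G : ℂ) * ((2 / q : ℂ) * (Y x - ∫ y : ℝ, ((k (x - y) : ℝ) : ℂ) * Y y)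
          - ∫ σ : ℝ, ((((2 * q - (x - σ) ^ 2) * (((x - σ) ^ 2 + q) ^ (5 / 2 : ℝ))⁻¹ : ℝ)) : ℂ) * (Y σ - ∫ y : ℝ, ((k (σ - y) : ℝ) : ℂ) * Y y))
        - ((w x : ℝ) : ℂ) * (deriv Y x - ∫ y : ℝ, ((k (x - y) : ℝ) : ℂ) * deriv Y y) + β₁ x * (Y x - ∫ y : ℝ, ((k (x - y) : ℝ) : ℂ) * Y y)
        + β₂ x * conj (Y x - ∫ y : ℝ, ((k (x - y) : ℝ) : ℂ) * Y y)
      = ((((( I * (G : ℂ) * ((2 / q : ℂ) * Y x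
              - ∫ σ : ℝ, ((((2 * q - (x - σ) ^ 2) * (((x - σ) ^ 2 + q) ^ (5 / 2 : ℝ))⁻¹ : ℝ)) : ℂ) * Y σ)
              - ((w x : ℝ) : ℂ) * deriv Y x + β₁ x * Y x + β₂ x * conj (Y x))
            - ∫ y : ℝ, ((k (x - y) : ℝ) : ℂ) * (I * (G : ℂ) * ((2 / q : ℂ) * Y y
              - ∫ σ : ℝ, ((((2 * q - (y - σ) ^ 2) * (((y - σ) ^ 2 + q) ^ (5 / 2 : ℝ))⁻¹ : ℝ)) : ℂ) * Y σ)
              - ((w y : ℝ) : ℂ) * deriv Y y + β₁ y * Y y + β₂ y * conj (Y y)))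
            + ((deriv w x : ℝ) : ℂ) * ∫ y : ℝ, (((x - y) * k' (x - y) + k (x - y) : ℝ) : ℂ) * Y y)
            - ∫ y : ℝ, ((k' (x - y) * (w y - w x - deriv w x * (y - x)) - k (x - y) * (deriv w y - deriv w x) : ℝ) : ℂ) * Y y)
            + ∫ y, ((k (x - y) : ℝ) : ℂ) * (β₁ y - β₁ x) * Y y)
            + ∫ y, ((k (x - y) : ℝ) : ℂ) * (β₂ y - β₂ x) * conj (Y y) := by
  have hkc : Continuous k := continuous_iff_continuousAt.2 fun t => (hk t).continuousAt
  have hYc := hY.continuous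
  have hY'c : Continuous (deriv Y) := hY.continuous_deriv le_rfl
  have hYd : ∀ y, HasDerivAt Y (deriv Y y) y := fun y => (hY.differentiable one_ne_zero y).hasDerivAt
  have hYi : Integrable Y := hYc.integrable_of_hasCompactSupport hYs
  have hP1 : Integrable fun x : ℝ => ∫ y : ℝ, ((k (x - y) : ℝ) : ℂ) * Y y := integrable_piece hki hYc hYs
  -- the piece operator and the refined commutator
  have hP := pieceOperator_eq (G := G) hq hkc hki hkM hY hYs hw.continuous hβ₁c.aestronglyMeasurable hβ₂c.aestronglyMeasurable hb₁ hb₂ x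
  have hTeq := transportCommutator_eq_main_add_remainder hk hk'c hw hw2 hΛ hYd hY'c hYs x
  -- linearity of the smoothing term
  have hIY := integrable_smoothingKernel_mul_of_integrable hq hYi x
  have hIP := integrable_smoothingKernel_mul_of_integrable hq hP1 x
  have hK : ∫ σ : ℝ, ((((2 * q - (x - σ) ^ 2) * (((x - σ) ^ 2 + q) ^ (5 / 2 : ℝ))⁻¹ : ℝ)) : ℂ) * (Y σ - ∫ y : ℝ, ((k (σ - y) : ℝ) : ℂ) * Y y)
      = (∫ σ : ℝ, ((((2 * q - (x - σ) ^ 2) * (((x - σ) ^ 2 + q) ^ (5 / 2 : ℝ))⁻¹ : ℝ)) : ℂ) * Y σ)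
        - ∫ σ : ℝ, ((((2 * q - (x - σ) ^ 2) * (((x - σ) ^ 2 + q) ^ (5 / 2 : ℝ))⁻¹ : ℝ)) : ℂ) * ∫ y : ℝ, ((k (σ - y) : ℝ) : ℂ) * Y y := by
    rw [← integral_sub hIY hIP]
    refine integral_congr_ae (ae_of_all _ fun σ => ?_); ring
  rw [hK, map_sub]
  -- `𝓛Y_H = 𝓛Y − 𝓛P`, then substitute `𝓛P` and the commutator split
  have e1 : I * (G : ℂ) * ((2 / q : ℂ) * (Y x - ∫ y : ℝ, ((k (x - y) : ℝ) : ℂ) * Y y)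
          - ((∫ σ : ℝ, ((((2 * q - (x - σ) ^ 2) * (((x - σ) ^ 2 + q) ^ (5 / 2 : ℝ))⁻¹ : ℝ)) : ℂ) * Y σ)
            - ∫ σ : ℝ, ((((2 * q - (x - σ) ^ 2) * (((x - σ) ^ 2 + q) ^ (5 / 2 : ℝ))⁻¹ : ℝ)) : ℂ) * ∫ y : ℝ, ((k (σ - y) : ℝ) : ℂ) * Y y))
        - ((w x : ℝ) : ℂ) * (deriv Y x - ∫ y : ℝ, ((k (x - y) : ℝ) : ℂ) * deriv Y y) + β₁ x * (Y x - ∫ y : ℝ, ((k (x - y) : ℝ) : ℂ) * Y y)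
        + β₂ x * (conj (Y x) - conj (∫ y : ℝ, ((k (x - y) : ℝ) : ℂ) * Y y))
      = (I * (G : ℂ) * ((2 / q : ℂ) * Y x
              - ∫ σ : ℝ, ((((2 * q - (x - σ) ^ 2) * (((x - σ) ^ 2 + q) ^ (5 / 2 : ℝ))⁻¹ : ℝ)) : ℂ) * Y σ)
              - ((w x : ℝ) : ℂ) * deriv Y x + β₁ x * Y x + β₂ x * conj (Y x))
        - (I * (G : ℂ) * ((2 / q : ℂ) * (∫ y : ℝ, ((k (x - y) : ℝ) : ℂ) * Y y)
            - ∫ σ : ℝ, ((((2 * q - (x - σ) ^ 2) * (((x - σ) ^ 2 + q) ^ (5 / 2 : ℝ))⁻¹ : ℝ)) : ℂ) * ∫ y : ℝ, ((k (σ - y) : ℝ) : ℂ) * Y y)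
          - ((w x : ℝ) : ℂ) * (∫ y : ℝ, ((k (x - y) : ℝ) : ℂ) * deriv Y y)
          + β₁ x * (∫ y : ℝ, ((k (x - y) : ℝ) : ℂ) * Y y) + β₂ x * conj (∫ y : ℝ, ((k (x - y) : ℝ) : ℂ) * Y y)) := by
    ring
  rw [e1, hP, hTeq]
  ring

/-- **SUP BOUND FOR `𝓛Y_H`.**  In the setting of `modelOperator_far_eq`, with moreover `t k, t²k′ ∈ L¹`, `|w″| ≤ Λ₂`, `‖β_i(y)−β_i(x)‖ ≤ L_i|y−x|`,
and everywhere `‖𝓛Y‖ ≤ S_L`, `‖Y‖ ≤ S_Y`: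
`‖𝓛Y_H(x)‖ ≤ (1+‖k‖₁)·S_L + Λ·‖P_T(x)‖ + (Λ₂(‖t²k′‖₁ + ‖t k‖₁) + (L₁+L₂)‖t k‖₁)·S_Y` at every `x`. [folklore] -/
theorem norm_modelOperator_far_le {q G : ℝ} (hq : 0 < q) {k k' : ℝ → ℝ} (hk : ∀ t, HasDerivAt k (k' t) t) (hk'c : Continuous k')
    (hki : Integrable k) (hk1 : Integrable fun t => t * k t) (hk'2 : Integrable fun t => t ^ 2 * k' t) {Mk : ℝ} (hkM : ∀ t, |k t| ≤ Mk)
    {Y : ℝ → ℂ} (hY : ContDiff ℝ 1 Y) (hYs : HasCompactSupport Y)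
    {w : ℝ → ℝ} (hw : Differentiable ℝ w) (hw2 : Differentiable ℝ (deriv w)) {Λ Λ₂ : ℝ} (hΛ : ∀ t, |deriv w t| ≤ Λ)
    (hΛ₂ : ∀ t, |deriv (deriv w) t| ≤ Λ₂)
    {β₁ β₂ : ℝ → ℂ} (hβ₁c : Continuous β₁) (hβ₂c : Continuous β₂) {b₁ b₂ L₁ L₂ : ℝ}
    (hb₁ : ∀ τ, ‖β₁ τ‖ ≤ b₁) (hb₂ : ∀ τ, ‖β₂ τ‖ ≤ b₂) (hL₁ : ∀ x y, ‖β₁ y - β₁ x‖ ≤ L₁ * |y - x|)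
    (hL₂ : ∀ x y, ‖β₂ y - β₂ x‖ ≤ L₂ * |y - x|)
    {SL SY : ℝ}
    (hSL : ∀ y : ℝ, ‖I * (G : ℂ) * ((2 / q : ℂ) * Y y
          - ∫ σ : ℝ, ((((2 * q - (y - σ) ^ 2) * (((y - σ) ^ 2 + q) ^ (5 / 2 : ℝ))⁻¹ : ℝ)) : ℂ) * Y σ)
        - ((w y : ℝ) : ℂ) * deriv Y y + β₁ y * Y y + β₂ y * conj (Y y)‖ ≤ SL)
    (hSY : ∀ y : ℝ, ‖Y y‖ ≤ SY) (x : ℝ) :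
    ‖I * (G : ℂ) * ((2 / q : ℂ) * (Y x - ∫ y : ℝ, ((k (x - y) : ℝ) : ℂ) * Y y)
          - ∫ σ : ℝ, ((((2 * q - (x - σ) ^ 2) * (((x - σ) ^ 2 + q) ^ (5 / 2 : ℝ))⁻¹ : ℝ)) : ℂ) * (Y σ - ∫ y : ℝ, ((k (σ - y) : ℝ) : ℂ) * Y y))
        - ((w x : ℝ) : ℂ) * (deriv Y x - ∫ y : ℝ, ((k (x - y) : ℝ) : ℂ) * deriv Y y) + β₁ x * (Y x - ∫ y : ℝ, ((k (x - y) : ℝ) : ℂ) * Y y)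
        + β₂ x * conj (Y x - ∫ y : ℝ, ((k (x - y) : ℝ) : ℂ) * Y y)‖
      ≤ (1 + ∫ t, |k t|) * SL + Λ * ‖∫ y : ℝ, (((x - y) * k' (x - y) + k (x - y) : ℝ) : ℂ) * Y y‖
        + (Λ₂ * ((∫ t, t ^ 2 * |k' t|) + (∫ t, |t| * |k t|)) + (L₁ + L₂) * (∫ t, |t| * |k t|)) * SY := by
  have hkc : Continuous k := continuous_iff_continuousAt.2 fun t => (hk t).continuousAt
  have hYc := hY.continuous
  rw [modelOperator_far_eq (G := G) hq hk hk'c hki hkM hY hYs hw hw2 hΛ hβ₁c hβ₂c hb₁ hb₂ x]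
  -- names
  set LY : ℝ → ℂ := fun y => I * (G : ℂ) * ((2 / q : ℂ) * Y y
          - ∫ σ : ℝ, ((((2 * q - (y - σ) ^ 2) * (((y - σ) ^ 2 + q) ^ (5 / 2 : ℝ))⁻¹ : ℝ)) : ℂ) * Y σ)
        - ((w y : ℝ) : ℂ) * deriv Y y + β₁ y * Y y + β₂ y * conj (Y y) with hLY
  set A : ℂ := ∫ y : ℝ, ((k (x - y) : ℝ) : ℂ) * LY y with hA
  set PT : ℂ := ∫ y : ℝ, (((x - y) * k' (x - y) + k (x - y) : ℝ) : ℂ) * Y y with hPT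
  set Rm : ℂ := ∫ y : ℝ, ((k' (x - y) * (w y - w x - deriv w x * (y - x)) - k (x - y) * (deriv w y - deriv w x) : ℝ) : ℂ) * Y y with hRm
  set M1 : ℂ := ∫ y, ((k (x - y) : ℝ) : ℂ) * (β₁ y - β₁ x) * Y y with hM1
  set M2 : ℂ := ∫ y, ((k (x - y) : ℝ) : ℂ) * (β₂ y - β₂ x) * conj (Y y) with hM2
  -- nonnegativity facts
  have hL1 : 0 ≤ L₁ := by
    have := hL₁ 0 1; rw [sub_zero, abs_one, mul_one] at this; exact (norm_nonneg _).trans this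
  have hL2 : 0 ≤ L₂ := by
    have := hL₂ 0 1; rw [sub_zero, abs_one, mul_one] at this; exact (norm_nonneg _).trans this
  have hΛ20 : 0 ≤ Λ₂ := (abs_nonneg _).trans (hΛ₂ 0)
  -- the six bounds
  have h0 : ‖LY x‖ ≤ SL := hSL x
  have h1 : ‖A‖ ≤ (∫ t, |k t|) * SL := norm_integral_kernel_mul_le_sup hki hSL x
  have h2 : ‖((deriv w x : ℝ) : ℂ) * PT‖ ≤ Λ * ‖PT‖ := by
    rw [norm_mul, Complex.norm_real, Real.norm_eq_abs]
    exact mul_le_mul_of_nonneg_right (hΛ x) (norm_nonneg _)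
  have h3 : ‖Rm‖ ≤ Λ₂ * ((∫ t, t ^ 2 * |k' t|) + (∫ t, |t| * |k t|)) * SY := by
    have hdom := norm_transportCommutatorRemainder_le hk hk'c hw hw2 hΛ₂ hYc hYs x
    set K : ℝ → ℝ := fun t => Λ₂ * (t ^ 2 * |k' t| + |t| * |k t|) with hK
    have hi1 : Integrable fun t => |t| * |k t| := by
      refine hk1.abs.congr (ae_of_all _ fun t => ?_); simp only [abs_mul]
    have hi2 : Integrable fun t => t ^ 2 * |k' t| := by
      refine hk'2.abs.congr (ae_of_all _ fun t => ?_); simp only [abs_mul, abs_pow, sq_abs]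
    have hKi : Integrable K := (hi2.add hi1).const_mul Λ₂
    have hsup := integral_kernel_mul_norm_le_sup hKi hYc hSY x
    have hKabs : ∫ t, |K t| = Λ₂ * ((∫ t, t ^ 2 * |k' t|) + ∫ t, |t| * |k t|) := by
      have habs : (fun t => |K t|) = fun t => Λ₂ * (t ^ 2 * |k' t| + |t| * |k t|) :=
        funext fun t => abs_of_nonneg (by positivity)
      rw [habs, integral_const_mul, integral_add hi2 hi1]
    have e : (fun y : ℝ => K (x - y) * ‖Y y‖) = fun y => (Λ₂ * ((x - y) ^ 2 * |k' (x - y)| + |x - y| * |k (x - y)|)) * ‖Y y‖ := rfl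
    rw [e, hKabs] at hsup
    exact hdom.trans hsup
  have h4 : ‖M1‖ ≤ L₁ * (∫ t, |t| * |k t|) * SY := by
    have hdom := norm_multiplierCommutator_le hkc hL₁ hYc hYs x
    set K : ℝ → ℝ := fun t => L₁ * (|t| * |k t|) with hK
    have hi1 : Integrable fun t => |t| * |k t| := by
      refine hk1.abs.congr (ae_of_all _ fun t => ?_); simp only [abs_mul]
    have hKi : Integrable K := hi1.const_mul L₁
    have hsup := integral_kernel_mul_norm_le_sup hKi hYc hSY x
    have hKabs : ∫ t, |K t| = L₁ * ∫ t, |t| * |k t| := by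
      have habs : (fun t => |K t|) = fun t => L₁ * (|t| * |k t|) := funext fun t => abs_of_nonneg (by positivity)
      rw [habs, integral_const_mul]
    have e : (fun y : ℝ => K (x - y) * ‖Y y‖) = fun y => (L₁ * (|x - y| * |k (x - y)|)) * ‖Y y‖ := rfl
    rw [e, hKabs] at hsup
    exact hdom.trans hsup
  have h5 : ‖M2‖ ≤ L₂ * (∫ t, |t| * |k t|) * SY := by
    have hYcc : Continuous fun y => conj (Y y) := Complex.continuous_conj.comp hYc
    have hYcs : HasCompactSupport fun y => conj (Y y) := hYs.comp_left (g := conj) (map_zero _)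
    have hdom := norm_multiplierCommutator_le (f := fun y => conj (Y y)) hkc hL₂ hYcc hYcs x
    set K : ℝ → ℝ := fun t => L₂ * (|t| * |k t|) with hK
    have hi1 : Integrable fun t => |t| * |k t| := by
      refine hk1.abs.congr (ae_of_all _ fun t => ?_); simp only [abs_mul]
    have hKi : Integrable K := hi1.const_mul L₂
    have hSY' : ∀ y : ℝ, ‖conj (Y y)‖ ≤ SY := fun y => by rw [Complex.norm_conj]; exact hSY y
    have hsup := integral_kernel_mul_norm_le_sup hKi hYcc hSY' x
    have hKabs : ∫ t, |K t| = L₂ * ∫ t, |t| * |k t| := by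
      have habs : (fun t => |K t|) = fun t => L₂ * (|t| * |k t|) := funext fun t => abs_of_nonneg (by positivity)
      rw [habs, integral_const_mul]
    have e : (fun y : ℝ => K (x - y) * ‖conj (Y y)‖) = fun y => (L₂ * (|x - y| * |k (x - y)|)) * ‖conj (Y y)‖ := rfl
    rw [e, hKabs] at hsup
    exact hdom.trans hsup
  -- triangle inequality
  calc ‖(((((LY x - A) + ((deriv w x : ℝ) : ℂ) * PT) - Rm) + M1) + M2)‖
      ≤ ‖LY x‖ + ‖A‖ + ‖((deriv w x : ℝ) : ℂ) * PT‖ + ‖Rm‖ + ‖M1‖ + ‖M2‖ := by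
        have t1 := norm_sub_le (LY x) A
        have t2 := norm_add_le (LY x - A) (((deriv w x : ℝ) : ℂ) * PT)
        have t3 := norm_sub_le ((LY x - A) + ((deriv w x : ℝ) : ℂ) * PT) Rm
        have t4 := norm_add_le (((LY x - A) + ((deriv w x : ℝ) : ℂ) * PT) - Rm) M1
        have t5 := norm_add_le ((((LY x - A) + ((deriv w x : ℝ) : ℂ) * PT) - Rm) + M1) M2
        linarith
    _ ≤ SL + (∫ t, |k t|) * SL + Λ * ‖PT‖ + Λ₂ * ((∫ t, t ^ 2 * |k' t|) + (∫ t, |t| * |k t|)) * SY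
          + L₁ * (∫ t, |t| * |k t|) * SY + L₂ * (∫ t, |t| * |k t|) * SY := by
        linarith
    _ = _ := by ring

/-! ## §3 The far piece solves the transport ODE of the fences -/

/-- `Y_H = Y − k∗Y` is differentiable with `Y_H′(x) = Y′(x) − ∫k(x−y)Y′(y)dy`. [folklore] -/
theorem hasDerivAt_far {k : ℝ → ℝ} (hkc : Continuous k) {Y : ℝ → ℂ} (hY : ContDiff ℝ 1 Y) (hYs : HasCompactSupport Y) (x : ℝ) :
    HasDerivAt (fun x : ℝ => Y x - ∫ y : ℝ, ((k (x - y) : ℝ) : ℂ) * Y y)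
      (deriv Y x - ∫ y : ℝ, ((k (x - y) : ℝ) : ℂ) * deriv Y y) x :=
  ((hY.differentiable one_ne_zero x).hasDerivAt).sub (hasDerivAt_piece hkc hY hYs x)

/-- **THE TRANSPORT ODE OF THE FAR PIECE (lab frame).**  Pure algebra: with `𝓛u = iG((2/q)u − K_q∗u) − wu′ + β₁u + β₂conj u` evaluated on
`u = Y_H = Y − k∗Y` (`u′ = Y′ − k∗Y′`) one has, at every `x`,
`w(x)·u′(x) = i(2G/q)·u(x) + β₁(x)u(x) + β₂(x)conj u(x) + f(x)`, `f(x) := −iG·(K_q∗u)(x) − (𝓛u)(x)` — the `hode` hypothesis of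
`waist_norm_le_of_damped` / `farBranch_norm_le_weighted` (constant multipliers) and of their `_var` twins, with rotation rate `2G/q`. [folklore] -/
theorem far_transport_ode (q G : ℝ) (hq : 0 < q) (k : ℝ → ℝ) (Y : ℝ → ℂ) (w : ℝ → ℝ) (β₁ β₂ : ℝ → ℂ) (x : ℝ) :
    ((w x : ℝ) : ℂ) * (deriv Y x - ∫ y : ℝ, ((k (x - y) : ℝ) : ℂ) * deriv Y y)
      = I * ((2 * G / q : ℝ) : ℂ) * (Y x - ∫ y : ℝ, ((k (x - y) : ℝ) : ℂ) * Y y)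
        + β₁ x * (Y x - ∫ y : ℝ, ((k (x - y) : ℝ) : ℂ) * Y y) + β₂ x * conj (Y x - ∫ y : ℝ, ((k (x - y) : ℝ) : ℂ) * Y y)
        + (-(I * (G : ℂ) * ∫ σ : ℝ, ((((2 * q - (x - σ) ^ 2) * (((x - σ) ^ 2 + q) ^ (5 / 2 : ℝ))⁻¹ : ℝ)) : ℂ)
              * (Y σ - ∫ y : ℝ, ((k (σ - y) : ℝ) : ℂ) * Y y))
           - (I * (G : ℂ) * ((2 / q : ℂ) * (Y x - ∫ y : ℝ, ((k (x - y) : ℝ) : ℂ) * Y y)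
                - ∫ σ : ℝ, ((((2 * q - (x - σ) ^ 2) * (((x - σ) ^ 2 + q) ^ (5 / 2 : ℝ))⁻¹ : ℝ)) : ℂ)
                    * (Y σ - ∫ y : ℝ, ((k (σ - y) : ℝ) : ℂ) * Y y))
              - ((w x : ℝ) : ℂ) * (deriv Y x - ∫ y : ℝ, ((k (x - y) : ℝ) : ℂ) * deriv Y y)
              + β₁ x * (Y x - ∫ y : ℝ, ((k (x - y) : ℝ) : ℂ) * Y y) + β₂ x * conj (Y x - ∫ y : ℝ, ((k (x - y) : ℝ) : ℂ) * Y y))) := by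
  have hq0 : (q : ℂ) ≠ 0 := by exact_mod_cast hq.ne'
  push_cast
  field_simp
  ring

/-- **SIZE OF THE FORCING**: `‖f(x)‖ ≤ G·‖(K_q∗Y_H)(x)‖ + ‖(𝓛Y_H)(x)‖` (`G ≥ 0`). [folklore] -/
theorem norm_far_forcing_le {G : ℝ} (hG : 0 ≤ G) (κ L : ℂ) : ‖-(I * (G : ℂ) * κ) - L‖ ≤ G * ‖κ‖ + ‖L‖ := by
  calc ‖-(I * (G : ℂ) * κ) - L‖ ≤ ‖-(I * (G : ℂ) * κ)‖ + ‖L‖ := norm_sub_le _ _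
    _ = G * ‖κ‖ + ‖L‖ := by
        rw [norm_neg, norm_mul, norm_mul, Complex.norm_I, one_mul, Complex.norm_real, Real.norm_of_nonneg hG]

end Summit.NavierStokesRegularity.NavierStokesRegularity.Theorems.MatchedKernel

end
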